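import Mathlib
import Literature.NumberTheory.Automorphic.ModularEisensteinContinuation

/-!
# The Eisenstein series of `SL₂(ℤ)` on the critical line: `C²` eigenfunctions by analytic continuation
(Iwaniec, *Spectral Methods of Automorphic Forms*, GSM 53, §3.4, PDF p. 47; Theorems 1.9, 1.15,
1.16, PDF pp. 21–24; (7.17), PDF p. 76)

Eighteenth layer of the `provefact` decomposition of `Literature.NumberTheory.Automorphic.sl2BallCount_asymp`
(`HyperbolicLatticeCount.lean`), ninth brick of the spectral theory of `L²(SL₂(ℤ)\\ℍ)` behind
`Iwaniec2002_thm_7_4_modular` (`ModularPretrace.lean`). It supplies the fields `E`,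
`automorphic_E`, `isC2_E`, `eigen_E`, `continuous_E` of `ModularSpectralDatum`: the continued
Eisenstein series `E(z, 1/2 + ir)` as an automorphic `C²` solution of `(Δ + 1/4 + r²)E = 0`,
continuous in `r`. Iwaniec takes the regularity of the continued series from the Fourier expansion
(3.20)/(3.29) ("the Fourier expansion furnishes the meromorphic continuation", p. 47); here it is
obtained from the completed series `E*(z, s) = Λ_z(s)/2` of `ModularEisensteinContinuation.lean` by
continuing the integral-operator identity `L_k E*(·, s) = h_k(t) E*(·, s)` (Theorem 1.16) from
`Re s > 1` to `ℂ ∖ {0, 1}` and invoking the regularity criterion of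
`InvariantOperatorRegularity.lean` (Theorems 1.9/1.15). Everything here is proved; nothing is vendored.

1. Box-uniform bounds for `Θ_w(t)` (`thetaQ_sub_one_le_of_mem_strip`, `thetaQ_sub_inv_bounds`) and
   an integrable majorant `C · max(1, t)^{-2}` of `t^{s-1} f_modif,w(t)` uniform for `w` in a box
   (`norm_mellinIntegrand_le`; `e^{-x} ≤ N!/x^N`).
2. Test weights `φ` (bounded, measurable, compact support) and the smoothed theta function
   `Θ_φ(t) = ∫ φ(w) Θ_w(t) dμ(w)`, again a Mellin FE-pair (`phiThetaFEPair`); **Fubini**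
   `∫ φ(w) Λ₀,w(s) dμ(w) = Λ̃₀(s)` for every `s` (`integral_mul_Lambda₀`), whence local integrability
   of `E*(·, s)` and `L_k E*(·, s)(z) = Λ̃(s)/2`, holomorphic in `s ∉ {0, 1}`.
3. **`L_k E*(·, s) = h_k(-i(s - 1/2)) E*(·, s)` for all `s ≠ 0, 1`** (`invariantOperator_completedEisenstein`)
   by the identity theorem on the connected open set `ℂ ∖ {0, 1}`; hence
   **`E*(·, s) ∈ C²`, `(Δ + s(1-s)) E*(·, s) = 0`** (`isC2_and_eigen_completedEisenstein`), and
   automorphy for all `s`.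
4. The critical line: `θ̂(s) = 2s(1 - 2s)Λ₀(2s) - 1`, entire, `= 2s(1-2s)θ(s)` off `{0, 1/2}`
   (`θ(s) = π^{-s}Γ(s)ζ(2s) = Λ(2s)`, (3.27)), non-vanishing on `Re s = 1/2`
   (`ζ(1 + 2ir) ≠ 0`); `eisensteinCrit z r := (2s(1-2s)/θ̂(s)) E*(z, s)`, `s = 1/2 + ir`, i.e.
   `E(z, 1/2 + ir) = E*(z, s)/θ(s)` regularised through the pole of `θ` at `s = 1/2` (where
   `E(z, 1/2) ≡ 0`, p. 47): automorphic, `C²`, `(Δ + 1/4 + r²)E = 0`, continuous in `r`, and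
   `L_k E(·, 1/2 + ir) = h_k(r) E(·, 1/2 + ir)`.

## References
* [Iwaniec2002] H. Iwaniec, *Spectral Methods of Automorphic Forms*, 2nd ed., GSM 53, AMS 2002,
  §3.4, PDF p. 47; §1.8 Theorems 1.9, 1.15, 1.16, PDF pp. 21–24; §7.4 (7.17), PDF p. 76.
-/

noncomputable section

namespace Literature.NumberTheory.Automorphic

open MeasureTheory Set Filter Real UpperHalfPlane EisensteinSeries
open scoped Topology MatrixGroups ModularForm ENNReal

section CriticalLine

/-! ### Uniform bounds for `Θ_w` on vertical boxes -/

/-- The decay constant `c = π r(A, B)²/Y` of the vertical box `|Re w| ≤ A`, `B ≤ Im w ≤ Y`. [folklore] -/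
noncomputable def cBox (A B Y : ℝ) (hB : 0 < B) : ℝ := π * r ⟨⟨A, B⟩, hB⟩ ^ 2 / Y

/-- `c > 0`. [folklore] -/
theorem cBox_pos {A B Y : ℝ} (hB : 0 < B) (hY : 0 < Y) : 0 < cBox A B Y hB := by
  unfold cBox; have := r_pos ⟨⟨A, B⟩, hB⟩; positivity

/-- The Gaussian lattice sum `D(a) = Σ_v e^{-a‖v‖²}`. [folklore] -/
noncomputable def latticeGaussSum (a : ℝ) : ℝ := ∑' v : Fin 2 → ℤ, Real.exp (-a * ‖v‖ ^ 2)

/-- `D(a) ≥ 0`. [folklore] -/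
theorem latticeGaussSum_nonneg (a : ℝ) : 0 ≤ latticeGaussSum a := tsum_nonneg fun _ => (Real.exp_pos _).le

/-- Termwise bound on a box: `e^{-π t Q_w(v)} ≤ e^{-c t ‖v‖²}`. [folklore] -/
theorem exp_qForm_le_of_mem_strip {A B Y : ℝ} (hB : 0 < B) {w : ℍ} (hw : w ∈ verticalStrip A B)
    (hY : w.im ≤ Y) {t : ℝ} (ht : 0 ≤ t) (v : Fin 2 → ℤ) :
    Real.exp (-π * t * qForm w v) ≤ Real.exp (-(cBox A B Y hB * t) * ‖v‖ ^ 2) := by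
  refine Real.exp_le_exp.mpr ?_
  have hq := qForm_ge_of_mem_strip hB hw hY v
  have h1 : π * t * (r ⟨⟨A, B⟩, hB⟩ ^ 2 * ‖v‖ ^ 2 / Y) ≤ π * t * qForm w v :=
    mul_le_mul_of_nonneg_left hq (by positivity)
  have e : -(cBox A B Y hB * t) * ‖v‖ ^ 2 = -(π * t * (r ⟨⟨A, B⟩, hB⟩ ^ 2 * ‖v‖ ^ 2 / Y)) := by
    unfold cBox; ring
  rw [e]; linarith

/-- **`Θ_w(t) ≤ D(c a)` for `t ≥ a > 0` and `w` in the box.** [folklore] -/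
theorem thetaQ_le_of_mem_strip {A B Y : ℝ} (hB : 0 < B) (hY0 : 0 < Y) {w : ℍ} (hw : w ∈ verticalStrip A B)
    (hY : w.im ≤ Y) {a t : ℝ} (ha : 0 < a) (hat : a ≤ t) :
    thetaQ w t ≤ latticeGaussSum (cBox A B Y hB * a) := by
  unfold thetaQ latticeGaussSum
  have hc := cBox_pos hB hY0 (A := A)
  refine Summable.tsum_le_tsum (fun v => ?_) (summable_exp_qForm w (ha.trans_le hat))
    (summable_exp_neg_mul_norm_sq (by positivity))
  refine (exp_qForm_le_of_mem_strip hB hw hY (ha.trans_le hat).le v).trans (Real.exp_le_exp.mpr ?_)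
  have : cBox A B Y hB * a * ‖v‖ ^ 2 ≤ cBox A B Y hB * t * ‖v‖ ^ 2 := by gcongr
  linarith

/-- **Uniform tail bound `Θ_w(t) - 1 ≤ e^{-c(t-1)} D(c)`** for `t ≥ 1` and `w` in the box. [folklore] -/
theorem thetaQ_sub_one_le_of_mem_strip {A B Y : ℝ} (hB : 0 < B) (hY0 : 0 < Y) {w : ℍ}
    (hw : w ∈ verticalStrip A B) (hY : w.im ≤ Y) {t : ℝ} (ht : 1 ≤ t) :
    thetaQ w t - 1 ≤ Real.exp (-(cBox A B Y hB * (t - 1))) * latticeGaussSum (cBox A B Y hB) := by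
  set c := cBox A B Y hB with hcdef
  have hc : 0 < c := cBox_pos hB hY0
  have h1 := summable_exp_qForm w (one_pos.trans_le ht)
  unfold thetaQ latticeGaussSum
  rw [h1.tsum_eq_add_tsum_ite 0]
  simp only [qForm_zero, mul_zero, Real.exp_zero, add_sub_cancel_left]
  rw [← tsum_mul_left]
  have hs2 : Summable fun v : Fin 2 → ℤ => Real.exp (-(c * (t - 1))) * Real.exp (-c * ‖v‖ ^ 2) :=
    (summable_exp_neg_mul_norm_sq hc).mul_left _
  refine Summable.tsum_le_tsum (fun v => ?_) ?_ hs2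
  · split_ifs with hv
    · positivity
    · refine (exp_qForm_le_of_mem_strip hB hw hY (zero_le_one.trans ht) v).trans ?_
      rw [← Real.exp_add]
      refine Real.exp_le_exp.mpr ?_
      have hv1 : (1 : ℝ) ≤ ‖v‖ ^ 2 := one_le_pow₀ (one_le_norm_of_ne_zero hv)
      have : c * (t - 1) * 1 ≤ c * (t - 1) * ‖v‖ ^ 2 :=
        mul_le_mul_of_nonneg_left hv1 (mul_nonneg hc.le (by linarith))
      rw [← hcdef]
      nlinarith
  · refine Summable.of_nonneg_of_le (fun v => ?_) (fun v => ?_) h1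
    · split_ifs <;> positivity
    · split_ifs with hv
      · positivity
      · exact le_rfl

/-- `Θ_w(t) = t⁻¹ Θ_w(1/t)` (`t > 0`). [folklore] -/
theorem thetaQ_eq_inv_mul (w : ℍ) {t : ℝ} (ht : 0 < t) : thetaQ w t = t⁻¹ * thetaQ w (1 / t) := by
  have h := thetaQ_functional_equation w (one_div_pos.mpr ht)
  rw [one_div_one_div] at h
  rw [h, one_div]

/-- On `(0, 1]`: `0 ≤ Θ_w(t) - t⁻¹ ≤ t⁻¹ e^{-c(1/t - 1)} D(c)` for `w` in the box. [folklore] -/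
theorem thetaQ_sub_inv_bounds {A B Y : ℝ} (hB : 0 < B) (hY0 : 0 < Y) {w : ℍ}
    (hw : w ∈ verticalStrip A B) (hY : w.im ≤ Y) {t : ℝ} (ht : 0 < t) (ht1 : t ≤ 1) :
    0 ≤ thetaQ w t - t⁻¹ ∧
      thetaQ w t - t⁻¹ ≤ t⁻¹ * (Real.exp (-(cBox A B Y hB * (1 / t - 1))) * latticeGaussSum (cBox A B Y hB)) := by
  have h1t : 1 ≤ 1 / t := by rw [le_div_iff₀ ht]; linarith
  have e : thetaQ w t - t⁻¹ = t⁻¹ * (thetaQ w (1 / t) - 1) := by rw [thetaQ_eq_inv_mul w ht]; ring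
  rw [e]
  refine ⟨mul_nonneg (inv_pos.mpr ht).le (by linarith [one_le_thetaQ w (one_pos.trans_le h1t)]), ?_⟩
  exact mul_le_mul_of_nonneg_left (thetaQ_sub_one_le_of_mem_strip hB hY0 hw hY h1t) (inv_pos.mpr ht).le

/-! ### An integrable majorant for the Mellin integrand, uniform on boxes -/

/-- `e^{-x} ≤ N!/x^N` for `x > 0`. [folklore] -/
theorem exp_neg_le_factorial_div_pow {x : ℝ} (hx : 0 < x) (N : ℕ) :
    Real.exp (-x) ≤ N.factorial / x ^ N := by
  have h := Real.pow_div_factorial_le_exp (x := x) hx.le N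
  have hN : (0 : ℝ) < N.factorial := Nat.cast_pos.mpr (Nat.factorial_pos N)
  rw [Real.exp_neg, inv_eq_one_div, div_le_div_iff₀ (Real.exp_pos _) (by positivity)]
  rw [div_le_iff₀ hN] at h
  linarith

/-- The majorant `C · max(1, t)^{-2}`. [folklore] -/
noncomputable def mellinMajorant (C : ℝ) (t : ℝ) : ℝ := C * max 1 t ^ (-2 : ℝ)

/-- The majorant is integrable on `(0, ∞)`. [folklore] -/
theorem integrableOn_mellinMajorant (C : ℝ) : IntegrableOn (mellinMajorant C) (Ioi 0) := by
  rw [← Ioc_union_Ioi_eq_Ioi zero_le_one]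
  refine IntegrableOn.union ?_ ?_
  · have : IntegrableOn (fun _ : ℝ => C) (Ioc 0 1) := integrableOn_const (by simp)
    refine this.congr_fun (fun t ht => ?_) measurableSet_Ioc
    unfold mellinMajorant
    rw [max_eq_left ht.2, Real.one_rpow, mul_one]
  · have : IntegrableOn (fun t : ℝ => C * t ^ (-2 : ℝ)) (Ioi 1) :=
      (integrableOn_Ioi_rpow_of_lt (by norm_num) one_pos).const_mul C
    refine this.congr_fun (fun t ht => ?_) measurableSet_Ioi
    unfold mellinMajorant
    rw [max_eq_right (le_of_lt ht)]

/-- The constant `C(c, D, σ) = D e^{c} N! c^{-N}`, `N = ⌈|σ|⌉ + 2`. [folklore] -/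
noncomputable def mellinConst (c D σ : ℝ) : ℝ :=
  D * Real.exp c * (Nat.factorial (⌈|σ|⌉₊ + 2) : ℝ) / c ^ (⌈|σ|⌉₊ + 2)

/-- `C ≥ 0`. [folklore] -/
theorem mellinConst_nonneg {c D : ℝ} (hc : 0 < c) (hD : 0 ≤ D) (σ : ℝ) : 0 ≤ mellinConst c D σ := by
  unfold mellinConst; positivity

/-- The explicit form of `f_modif` for the theta FE-pair. [folklore] -/
theorem f_modif_thetaFEPair (w : ℍ) (t : ℝ) : (thetaFEPair w).f_modif t =
    (Ioi 1).indicator (fun x : ℝ => (thetaQ w x : ℂ) - 1) t +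
      (Ioo 0 1).indicator (fun x : ℝ => (thetaQ w x : ℂ) - (x⁻¹ : ℝ)) t := by
  rw [WeakFEPair.f_modif]
  simp only [thetaFEPair, Pi.add_apply]
  congr 1
  refine congrFun (Set.indicator_congr fun x _ => ?_) t
  simp [Real.rpow_neg_one]

/-- **The majorant bound**: for `w` in the box and `t > 0`,
`‖t^{s-1} f_modif,w(t)‖ ≤ C(c, D(c), Re s) · max(1,t)^{-2}`. [folklore] -/
theorem norm_mellinIntegrand_le {A B Y : ℝ} (hB : 0 < B) (hY0 : 0 < Y) {w : ℍ}
    (hw : w ∈ verticalStrip A B) (hY : w.im ≤ Y) (s : ℂ) {t : ℝ} (ht : 0 < t) :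
    ‖(t : ℂ) ^ (s - 1) * (thetaFEPair w).f_modif t‖ ≤
      mellinMajorant (mellinConst (cBox A B Y hB) (latticeGaussSum (cBox A B Y hB)) s.re) t := by
  set c := cBox A B Y hB with hcdef
  set D := latticeGaussSum (cBox A B Y hB) with hDdef
  set N : ℕ := ⌈|s.re|⌉₊ + 2 with hNdef
  have hc : 0 < c := cBox_pos hB hY0
  have hD : 0 ≤ D := latticeGaussSum_nonneg _
  have hN : |s.re| + 2 ≤ (N : ℝ) := by
    rw [hNdef]; push_cast; linarith [Nat.le_ceil |s.re|]
  have habs := le_abs_self s.re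
  have habs' := neg_abs_le s.re
  have hCdef : mellinConst c D s.re = D * Real.exp c * (N.factorial : ℝ) / c ^ N := rfl
  have hC0 : 0 ≤ mellinConst c D s.re := mellinConst_nonneg hc hD _
  have hnt : ‖(t : ℂ) ^ (s - 1)‖ = t ^ (s.re - 1) := by
    rw [Complex.norm_cpow_eq_rpow_re_of_pos ht]; simp
  rw [f_modif_thetaFEPair, norm_mul, hnt]
  unfold mellinMajorant
  rcases lt_trichotomy t 1 with h1 | rfl | h1
  · -- 0 < t < 1
    rw [Set.indicator_of_notMem (by simp [h1.le] : t ∉ Ioi (1 : ℝ)), zero_add,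
      Set.indicator_of_mem (by exact ⟨ht, h1⟩ : t ∈ Ioo (0 : ℝ) 1), max_eq_left h1.le, Real.one_rpow, mul_one]
    obtain ⟨h0, hle⟩ := thetaQ_sub_inv_bounds hB hY0 hw hY ht h1.le
    rw [← Complex.ofReal_sub, Complex.norm_real, Real.norm_eq_abs, abs_of_nonneg h0]
    -- e^{-c(1/t - 1)} = e^{c} e^{-c/t} ≤ e^{c} N! (t/c)^N
    have hexp : Real.exp (-(c * (1 / t - 1))) ≤ Real.exp c * ((N.factorial : ℝ) / (c / t) ^ N) := by
      rw [show -(c * (1 / t - 1)) = c + -(c / t) by ring, Real.exp_add]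
      exact mul_le_mul_of_nonneg_left (exp_neg_le_factorial_div_pow (by positivity) N) (Real.exp_pos _).le
    have key : t ^ (s.re - 1) * (thetaQ w t - t⁻¹) ≤ mellinConst c D s.re * t ^ (s.re - 2 + N) := by
      calc t ^ (s.re - 1) * (thetaQ w t - t⁻¹)
          ≤ t ^ (s.re - 1) * (t⁻¹ * (Real.exp c * ((N.factorial : ℝ) / (c / t) ^ N) * D)) := by
            refine mul_le_mul_of_nonneg_left (hle.trans ?_) (by positivity)
            exact mul_le_mul_of_nonneg_left (mul_le_mul_of_nonneg_right hexp hD) (by positivity)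
        _ = mellinConst c D s.re * (t ^ (s.re - 1) * t⁻¹ * t ^ (N : ℝ)) := by
            rw [hCdef, div_pow, ← Real.rpow_natCast t N]
            field_simp
        _ = mellinConst c D s.re * t ^ (s.re - 2 + N) := by
            congr 1
            rw [← Real.rpow_neg_one, ← Real.rpow_add ht, ← Real.rpow_add ht]
            ring_nf
    refine key.trans ?_
    refine mul_le_of_le_one_right hC0 (Real.rpow_le_one ht.le h1.le ?_)
    linarith
  · -- t = 1
    simp only [Set.mem_Ioi, lt_self_iff_false, not_false_eq_true, Set.indicator_of_notMem, Set.mem_Ioo,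
      and_false, add_zero, norm_zero, mul_zero, max_self, Real.one_rpow, mul_one]
    exact hC0
  · -- t > 1
    rw [Set.indicator_of_mem (by exact h1 : t ∈ Ioi (1 : ℝ)),
      Set.indicator_of_notMem (by simp [h1.le] : t ∉ Ioo (0 : ℝ) 1), add_zero, max_eq_right h1.le]
    have h0 : 0 ≤ thetaQ w t - 1 := by linarith [one_le_thetaQ w ht]
    rw [← Complex.ofReal_one, ← Complex.ofReal_sub, Complex.norm_real, Real.norm_eq_abs, abs_of_nonneg h0]
    have hle := thetaQ_sub_one_le_of_mem_strip hB hY0 hw hY h1.le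
    have hexp : Real.exp (-(c * (t - 1))) ≤ Real.exp c * ((N.factorial : ℝ) / (c * t) ^ N) := by
      rw [show -(c * (t - 1)) = c + -(c * t) by ring, Real.exp_add]
      exact mul_le_mul_of_nonneg_left (exp_neg_le_factorial_div_pow (by positivity) N) (Real.exp_pos _).le
    have key : t ^ (s.re - 1) * (thetaQ w t - 1) ≤ mellinConst c D s.re * t ^ (s.re - 1 - N) := by
      calc t ^ (s.re - 1) * (thetaQ w t - 1)
          ≤ t ^ (s.re - 1) * (Real.exp c * ((N.factorial : ℝ) / (c * t) ^ N) * D) := by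
            refine mul_le_mul_of_nonneg_left (hle.trans ?_) (by positivity)
            exact mul_le_mul_of_nonneg_right hexp hD
        _ = mellinConst c D s.re * (t ^ (s.re - 1) * (t ^ (N : ℝ))⁻¹) := by
            rw [hCdef, mul_pow, ← Real.rpow_natCast t N]
            field_simp
        _ = mellinConst c D s.re * t ^ (s.re - 1 - N) := by
            congr 1
            rw [← Real.rpow_neg ht.le, ← Real.rpow_add ht]
            ring_nf
    refine key.trans (mul_le_mul_of_nonneg_left ?_ hC0)
    exact Real.rpow_le_rpow_of_exponent_le h1.le (by linarith)

/-! ### Test weights and the smoothed theta FE-pair -/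

/-- A test weight: measurable, bounded, vanishing off a compact set (e.g. `w ↦ k(u(z, w))` for a test
kernel, or the indicator of a compact set). [folklore] -/
structure IsTestWeight (φ : ℍ → ℝ) : Prop where
  measurable : Measurable φ
  bounded : ∃ B, ∀ w, |φ w| ≤ B
  compact_support : ∃ K : Set ℍ, IsCompact K ∧ ∀ w ∉ K, φ w = 0

/-- `w ↦ k(u(z, w))` is a test weight for a test kernel `k`. [folklore] -/
theorem isTestWeight_kernel {k : ℝ → ℝ} (hk : IsTestKernel k) (z : ℍ) :
    IsTestWeight fun w => k (pointPairInv z w) := by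
  obtain ⟨hkm, ⟨Bk, hBk⟩, ⟨M, hM0, hM⟩⟩ := id hk
  refine ⟨measurable_kernel hkm z, ⟨Bk, fun w => hBk _⟩,
    ⟨Metric.closedBall z (2 * Real.arsinh (Real.sqrt M)), isCompact_closedBall _ _, fun w hw => ?_⟩⟩
  rw [Metric.mem_closedBall, not_le, dist_comm] at hw
  exact kernel_eq_zero_of_dist hM hw

/-- The indicator of a compact set is a test weight. [folklore] -/
theorem isTestWeight_indicator {K : Set ℍ} (hK : IsCompact K) : IsTestWeight (K.indicator fun _ => (1 : ℝ)) := by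
  refine ⟨(measurable_const.indicator hK.isClosed.measurableSet), ⟨1, fun w => ?_⟩, ⟨K, hK, fun w hw => ?_⟩⟩
  · by_cases hw : w ∈ K <;> simp [hw]
  · simp [hw]

/-- A compact set lies in a box `|Re w| ≤ A`, `0 < B ≤ Im w ≤ Y` with `Y > 0`. [folklore] -/
theorem exists_box {K : Set ℍ} (hK : IsCompact K) :
    ∃ A B Y : ℝ, ∃ _ : 0 < B, 0 < Y ∧ ∀ w ∈ K, w ∈ verticalStrip A B ∧ w.im ≤ Y := by
  obtain ⟨A, B, Y, hB, h⟩ := exists_strip_of_isCompact hK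
  exact ⟨A, B, max Y 1, hB, by positivity, fun w hw => ⟨(h w hw).1, (h w hw).2.trans (le_max_left _ _)⟩⟩

/-- Integrability of `φ · g` for a test weight `φ` and locally integrable `g`. [folklore] -/
theorem IsTestWeight.integrable_mul {φ : ℍ → ℝ} (hφ : IsTestWeight φ) {g : ℍ → ℂ} (hg : LocallyIntegrable g) :
    Integrable fun w => (φ w : ℂ) * g w := by
  obtain ⟨hm, ⟨Bφ, hB⟩, ⟨K, hK, hφK⟩⟩ := hφ
  have h1 : IntegrableOn (fun w => (φ w : ℂ) * g w) K := by
    refine Integrable.bdd_mul (c := Bφ) (hg.integrableOn_isCompact hK) ?_ ?_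
    · exact (Complex.measurable_ofReal.comp hm).aestronglyMeasurable
    · refine Eventually.of_forall fun w => ?_
      rw [Complex.norm_real, Real.norm_eq_abs]
      exact hB _
  refine h1.integrable_of_forall_notMem_eq_zero fun w hw => ?_
  simp [hφK w hw]

/-- **The smoothed theta function `Θ_φ(t) = ∫ φ(w) Θ_w(t) dμ(w)`.** [folklore] -/
noncomputable def phiTheta (φ : ℍ → ℝ) (t : ℝ) : ℂ := ∫ w, (φ w : ℂ) * (thetaQ w t : ℂ)

/-- Its constant term `∫ φ dμ`. [folklore] -/
noncomputable def phiMass (φ : ℍ → ℝ) : ℂ := ∫ w, (φ w : ℂ)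

/-- **Functional equation of the smoothed theta function**: `Θ_φ(1/t) = t Θ_φ(t)`. [folklore] -/
theorem phiTheta_functional_equation (φ : ℍ → ℝ) {t : ℝ} (ht : 0 < t) :
    phiTheta φ (1 / t) = t * phiTheta φ t := by
  unfold phiTheta
  rw [← integral_const_mul]
  refine integral_congr_ae (Eventually.of_forall fun w => ?_)
  simp only [thetaQ_functional_equation w ht, Complex.ofReal_mul]
  ring

/-- Continuity of `t ↦ Θ_φ(t)` on `(0, ∞)` (dominated convergence on the compact support). [folklore] -/
theorem continuousOn_phiTheta {φ : ℍ → ℝ} (hφ : IsTestWeight φ) : ContinuousOn (phiTheta φ) (Ioi 0) := by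
  obtain ⟨hm, ⟨Bφ, hB⟩, ⟨K, hK, hφK⟩⟩ := hφ
  obtain ⟨A, B, Y, hBpos, hY0, hbox⟩ := exists_box hK
  intro t₀ ht₀
  have ht₀' : (0 : ℝ) < t₀ := ht₀
  set a : ℝ := t₀ / 2 with hadef
  have ha : 0 < a := by positivity
  have hKm : MeasurableSet K := hK.isClosed.measurableSet
  have hKfin : volume K < ∞ := hK.measure_lt_top
  refine (continuousAt_of_dominated (μ := volume) (F := fun t w => (φ w : ℂ) * (thetaQ w t : ℂ)) (x₀ := t₀)
    (bound := K.indicator fun _ => |Bφ| * latticeGaussSum (cBox A B Y hBpos * a)) ?_ ?_ ?_ ?_).continuousWithinAt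
  · filter_upwards [Ioi_mem_nhds ht₀'] with t ht
    exact ((Complex.measurable_ofReal.comp hm).mul
      (Complex.measurable_ofReal.comp (continuous_thetaQ_left ht).measurable)).aestronglyMeasurable
  · filter_upwards [Ioi_mem_nhds (show a < t₀ by rw [hadef]; linarith)] with t ht
    refine Eventually.of_forall fun w => ?_
    by_cases hw : w ∈ K
    · have hΘ : (0 : ℝ) ≤ thetaQ w t := by linarith [one_le_thetaQ w (ha.trans ht)]
      rw [Set.indicator_of_mem hw, norm_mul, Complex.norm_real, Complex.norm_real, Real.norm_eq_abs,
        Real.norm_eq_abs, abs_of_nonneg hΘ]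
      refine mul_le_mul ((hB w).trans (le_abs_self _)) ?_ hΘ (abs_nonneg _)
      exact thetaQ_le_of_mem_strip hBpos hY0 (hbox w hw).1 (hbox w hw).2 ha (le_of_lt ht)
    · rw [Set.indicator_of_notMem hw, hφK w hw]; simp
  · exact (integrableOn_const hKfin.ne).integrable_indicator hKm
  · refine Eventually.of_forall fun w => ?_
    have h1 : ContinuousAt (fun t => thetaQ w t) t₀ := (continuousOn_thetaQ w).continuousAt (Ioi_mem_nhds ht₀')
    exact continuousAt_const.mul (Complex.continuous_ofReal.continuousAt.comp h1)

/-- Integrability of `w ↦ φ(w) Θ_w(t)` (`t > 0`). [folklore] -/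
theorem IsTestWeight.integrable_mul_thetaQ {φ : ℍ → ℝ} (hφ : IsTestWeight φ) {t : ℝ} (ht : 0 < t) :
    Integrable fun w => (φ w : ℂ) * (thetaQ w t : ℂ) :=
  hφ.integrable_mul ((Complex.continuous_ofReal.comp (continuous_thetaQ_left ht)).locallyIntegrable)

/-- **Decay of the smoothed theta function**: `‖Θ_φ(t) - ∫φ‖ ≤ B μ(K) D e^{-c(t-1)}` for `t ≥ 1`,
hence `Θ_φ(t) - ∫φ = O(t^b)` for every `b`. [folklore] -/
theorem isBigO_phiTheta_sub {φ : ℍ → ℝ} (hφ : IsTestWeight φ) (b : ℝ) :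
    (fun t : ℝ => phiTheta φ t - phiMass φ) =O[atTop] (· ^ b) := by
  obtain ⟨hm, ⟨Bφ, hB⟩, ⟨K, hK, hφK⟩⟩ := id hφ
  obtain ⟨A, B, Y, hBpos, hY0, hbox⟩ := exists_box hK
  set c := cBox A B Y hBpos with hcdef
  have hc : 0 < c := cBox_pos hBpos hY0
  set D := latticeGaussSum c
  have hKm : MeasurableSet K := hK.isClosed.measurableSet
  have hKfin : volume K < ∞ := hK.measure_lt_top
  have h1 : (fun t : ℝ => phiTheta φ t - phiMass φ) =O[atTop] fun t => Real.exp (-c * t) := by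
    refine Asymptotics.IsBigO.of_bound (|Bφ| * D * Real.exp c * (volume K).toReal) ?_
    filter_upwards [eventually_ge_atTop (1 : ℝ)] with t ht
    have ht0 : 0 < t := one_pos.trans_le ht
    have hint := hφ.integrable_mul_thetaQ ht0
    have hint1 : Integrable fun w => (φ w : ℂ) := by
      simpa using hφ.integrable_mul (g := fun _ => (1 : ℂ)) (locallyIntegrable_const 1)
    have e : phiTheta φ t - phiMass φ = ∫ w, (φ w : ℂ) * ((thetaQ w t : ℂ) - 1) := by
      unfold phiTheta phiMass
      rw [← integral_sub hint hint1]
      congr 1 with w; ring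
    rw [e, Real.norm_eq_abs, abs_of_pos (Real.exp_pos _)]
    have hbd : ∀ w, ‖(φ w : ℂ) * ((thetaQ w t : ℂ) - 1)‖ ≤
        K.indicator (fun _ => |Bφ| * D * Real.exp c * Real.exp (-c * t)) w := by
      intro w
      by_cases hw : w ∈ K
      · have hΘ : (0 : ℝ) ≤ thetaQ w t - 1 := by linarith [one_le_thetaQ w ht0]
        rw [Set.indicator_of_mem hw, norm_mul, Complex.norm_real, Real.norm_eq_abs, ← Complex.ofReal_one,
          ← Complex.ofReal_sub, Complex.norm_real, Real.norm_eq_abs, abs_of_nonneg hΘ]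
        have hle := thetaQ_sub_one_le_of_mem_strip hBpos hY0 (hbox w hw).1 (hbox w hw).2 ht
        have e2 : Real.exp (-(c * (t - 1))) * D = D * Real.exp c * Real.exp (-c * t) := by
          rw [show -(c * (t - 1)) = c + -c * t by ring, Real.exp_add]; ring
        rw [← hcdef, e2] at hle
        calc |φ w| * (thetaQ w t - 1) ≤ |Bφ| * (D * Real.exp c * Real.exp (-c * t)) :=
              mul_le_mul ((hB w).trans (le_abs_self _)) hle (by linarith [one_le_thetaQ w ht0]) (abs_nonneg _)
          _ = |Bφ| * D * Real.exp c * Real.exp (-c * t) := by ring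
      · rw [Set.indicator_of_notMem hw, hφK w hw]; simp
    refine (norm_integral_le_of_norm_le ((integrableOn_const hKfin.ne).integrable_indicator hKm)
      (Eventually.of_forall hbd)).trans (le_of_eq ?_)
    rw [integral_indicator_const _ hKm, smul_eq_mul, Measure.real]
    ring
  exact h1.trans (isLittleO_exp_neg_mul_rpow_atTop hc b).isBigO

/-- **The smoothed theta FE-pair** `(Θ_φ, k = 1, ε = 1, f₀ = g₀ = ∫φ)`. [folklore] -/
noncomputable def phiThetaFEPair {φ : ℍ → ℝ} (hφ : IsTestWeight φ) : WeakFEPair ℂ where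
  f := phiTheta φ
  g := phiTheta φ
  k := 1
  ε := 1
  f₀ := phiMass φ
  g₀ := phiMass φ
  hf_int := (continuousOn_phiTheta hφ).locallyIntegrableOn measurableSet_Ioi
  hg_int := (continuousOn_phiTheta hφ).locallyIntegrableOn measurableSet_Ioi
  hk := one_pos
  hε := one_ne_zero
  h_feq := fun x hx => by
    simp only [Real.rpow_one, one_mul, smul_eq_mul]
    rw [phiTheta_functional_equation φ hx]
  hf_top := fun r => isBigO_phiTheta_sub hφ r
  hg_top := fun r => isBigO_phiTheta_sub hφ r

/-- The explicit form of `f_modif` for the smoothed pair. [folklore] -/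
theorem f_modif_phiThetaFEPair {φ : ℍ → ℝ} (hφ : IsTestWeight φ) (t : ℝ) : (phiThetaFEPair hφ).f_modif t =
    (Ioi 1).indicator (fun x : ℝ => phiTheta φ x - phiMass φ) t +
      (Ioo 0 1).indicator (fun x : ℝ => phiTheta φ x - (x⁻¹ : ℝ) * phiMass φ) t := by
  rw [WeakFEPair.f_modif]
  simp only [phiThetaFEPair, Pi.add_apply]
  congr 1
  refine congrFun (Set.indicator_congr fun x _ => ?_) t
  simp [Real.rpow_neg_one]

/-- `∫ φ(w) f_modif,w(t) dμ(w) = f̃_modif(t)`: the modification is linear. [folklore] -/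
theorem integral_mul_f_modif {φ : ℍ → ℝ} (hφ : IsTestWeight φ) {t : ℝ} (ht : 0 < t) :
    ∫ w, (φ w : ℂ) * (thetaFEPair w).f_modif t = (phiThetaFEPair hφ).f_modif t := by
  have hint := hφ.integrable_mul_thetaQ ht
  have hint1 : Integrable fun w => (φ w : ℂ) := by
    simpa using hφ.integrable_mul (g := fun _ => (1 : ℂ)) (locallyIntegrable_const 1)
  simp_rw [f_modif_thetaFEPair, f_modif_phiThetaFEPair hφ]
  rcases lt_trichotomy t 1 with h1 | rfl | h1
  · simp_rw [Set.indicator_of_notMem (by simp [h1.le] : t ∉ Ioi (1 : ℝ)), zero_add,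
      Set.indicator_of_mem (by exact ⟨ht, h1⟩ : t ∈ Ioo (0 : ℝ) 1)]
    unfold phiTheta phiMass
    rw [← integral_const_mul, ← integral_sub hint (hint1.const_mul _)]
    congr 1 with w; ring
  · have e1 : (1 : ℝ) ∉ Ioi (1 : ℝ) := by simp
    have e2 : (1 : ℝ) ∉ Ioo (0 : ℝ) 1 := by simp
    simp only [Set.indicator_of_notMem e1, Set.indicator_of_notMem e2, add_zero, mul_zero, integral_zero]
  · simp_rw [Set.indicator_of_mem (by exact h1 : t ∈ Ioi (1 : ℝ)),
      Set.indicator_of_notMem (by simp [h1.le] : t ∉ Ioo (0 : ℝ) 1), add_zero]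
    unfold phiTheta phiMass
    rw [← integral_sub hint hint1]
    congr 1 with w; ring


/-! ### Fubini: `∫ φ(w) Λ₀,w(s) dμ(w) = Λ̃₀(s)` -/

/-- The second coordinate is a.e. positive for `μ ⊗ vol|_{(0,∞)}`. [folklore] -/
theorem ae_snd_pos : ∀ᵐ p : ℍ × ℝ ∂((volume : Measure ℍ).prod (volume.restrict (Ioi (0 : ℝ)))), 0 < p.2 := by
  rw [ae_iff]
  have e : {p : ℍ × ℝ | ¬0 < p.2} = (univ : Set ℍ) ×ˢ (Ioi (0 : ℝ))ᶜ := by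
    ext p; simp
  rw [e, Measure.prod_prod, Measure.restrict_apply measurableSet_Ioi.compl, Set.compl_inter_self,
    measure_empty, mul_zero]

/-- `(w, t) ↦ Θ_w(t)` is a.e.-strongly measurable on `ℍ × (0, ∞)`. [folklore] -/
theorem aestronglyMeasurable_thetaQ_prod :
    AEStronglyMeasurable (fun p : ℍ × ℝ => (thetaQ p.1 p.2 : ℂ))
      ((volume : Measure ℍ).prod (volume.restrict (Ioi (0 : ℝ)))) := by
  have hc : ContinuousOn (fun p : ℍ × ℝ => (thetaQ p.1 p.2 : ℂ)) (univ ×ˢ Ioi 0) := fun p hp =>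
    (Complex.continuous_ofReal.continuousAt.comp (continuousAt_thetaQ p.1 hp.2)).continuousWithinAt
  have h := hc.aestronglyMeasurable (MeasurableSet.univ.prod measurableSet_Ioi)
    (μ := (volume : Measure ℍ).prod (volume : Measure ℝ))
  rwa [← Measure.prod_restrict, Measure.restrict_univ] at h

/-- `(w, t) ↦ f_modif,w(t)` is a.e.-strongly measurable on `ℍ × (0, ∞)`. [folklore] -/
theorem aestronglyMeasurable_f_modif_prod :
    AEStronglyMeasurable (fun p : ℍ × ℝ => (thetaFEPair p.1).f_modif p.2)
      ((volume : Measure ℍ).prod (volume.restrict (Ioi (0 : ℝ)))) := by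
  have e : (fun p : ℍ × ℝ => (thetaFEPair p.1).f_modif p.2) =
      {p : ℍ × ℝ | p.2 ∈ Ioi 1}.indicator (fun p => (thetaQ p.1 p.2 : ℂ) - 1) +
        {p : ℍ × ℝ | p.2 ∈ Ioo 0 1}.indicator (fun p => (thetaQ p.1 p.2 : ℂ) - ((p.2⁻¹ : ℝ) : ℂ)) := by
    funext p
    rw [f_modif_thetaFEPair]
    simp only [Pi.add_apply, Set.indicator_apply, Set.mem_setOf_eq]
  rw [e]
  have hΘ := aestronglyMeasurable_thetaQ_prod
  refine ((hΘ.sub aestronglyMeasurable_const).indicator ?_).add ((hΘ.sub ?_).indicator ?_)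
  · exact measurableSet_Ioi.preimage measurable_snd
  · exact (Complex.measurable_ofReal.comp (measurable_inv.comp measurable_snd)).aestronglyMeasurable
  · exact measurableSet_Ioo.preimage measurable_snd

/-- **Fubini for the Mellin transforms**: `w ↦ φ(w) Λ₀,w(s)` is integrable and
`∫ φ(w) Λ₀,w(s) dμ(w) = Λ̃₀(s)`, the entire Mellin transform of the smoothed pair — for *every* `s`,
thanks to the box-uniform majorant. [folklore] -/
theorem integral_mul_Lambda₀ {φ : ℍ → ℝ} (hφ : IsTestWeight φ) (s : ℂ) :
    Integrable (fun w => (φ w : ℂ) * (thetaFEPair w).Λ₀ s) ∧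
      ∫ w, (φ w : ℂ) * (thetaFEPair w).Λ₀ s = (phiThetaFEPair hφ).Λ₀ s := by
  obtain ⟨hm, ⟨Bφ, hB⟩, ⟨K, hK, hφK⟩⟩ := id hφ
  obtain ⟨A, B, Y, hBpos, hY0, hbox⟩ := exists_box hK
  set C := mellinConst (cBox A B Y hBpos) (latticeGaussSum (cBox A B Y hBpos)) s.re with hCdef
  have hKm : MeasurableSet K := hK.isClosed.measurableSet
  have hKfin : volume K < ∞ := hK.measure_lt_top
  set F : ℍ → ℝ → ℂ := fun w t => (φ w : ℂ) * ((t : ℂ) ^ (s - 1) * (thetaFEPair w).f_modif t) with hF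
  have hint : Integrable (Function.uncurry F) ((volume : Measure ℍ).prod (volume.restrict (Ioi (0 : ℝ)))) := by
    have hmeas : AEStronglyMeasurable (Function.uncurry F)
        ((volume : Measure ℍ).prod (volume.restrict (Ioi (0 : ℝ)))) := by
      refine ((Complex.measurable_ofReal.comp (hm.comp measurable_fst)).aestronglyMeasurable).mul
        ((((Complex.measurable_ofReal.comp measurable_snd).pow_const _).aestronglyMeasurable).mul
          aestronglyMeasurable_f_modif_prod)
    have hG : Integrable (fun p : ℍ × ℝ => K.indicator (fun _ => |Bφ|) p.1 * mellinMajorant C p.2)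
        ((volume : Measure ℍ).prod (volume.restrict (Ioi (0 : ℝ)))) :=
      Integrable.mul_prod ((integrableOn_const hKfin.ne).integrable_indicator hKm) (integrableOn_mellinMajorant C)
    refine hG.mono' hmeas ?_
    filter_upwards [ae_snd_pos] with p hp
    show ‖(φ p.1 : ℂ) * ((p.2 : ℂ) ^ (s - 1) * (thetaFEPair p.1).f_modif p.2)‖ ≤ _
    by_cases hw : p.1 ∈ K
    · rw [Set.indicator_of_mem hw, norm_mul, Complex.norm_real, Real.norm_eq_abs]
      exact mul_le_mul ((hB _).trans (le_abs_self _))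
        (norm_mellinIntegrand_le hBpos hY0 (hbox _ hw).1 (hbox _ hw).2 s hp) (norm_nonneg _) (abs_nonneg _)
    · rw [hφK _ hw, Set.indicator_of_notMem hw]
      simp
  have hswap := integral_integral_swap hint
  have hL : ∀ w, ∫ t in Ioi 0, F w t = (φ w : ℂ) * (thetaFEPair w).Λ₀ s := by
    intro w
    simp only [hF]
    rw [integral_const_mul, WeakFEPair.Λ₀, mellin]
    simp_rw [smul_eq_mul]
  have hR : ∀ t ∈ Ioi (0 : ℝ), ∫ w, F w t = (t : ℂ) ^ (s - 1) * (phiThetaFEPair hφ).f_modif t := by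
    intro t ht
    simp only [hF]
    have e : ∀ w, (φ w : ℂ) * ((t : ℂ) ^ (s - 1) * (thetaFEPair w).f_modif t) =
        (t : ℂ) ^ (s - 1) * ((φ w : ℂ) * (thetaFEPair w).f_modif t) := fun w => by ring
    simp_rw [e]
    rw [integral_const_mul, integral_mul_f_modif hφ ht]
  refine ⟨?_, ?_⟩
  · have h := hint.integral_prod_left
    have e : (fun w => ∫ t in Ioi 0, Function.uncurry F (w, t)) = fun w => (φ w : ℂ) * (thetaFEPair w).Λ₀ s := by
      funext w; exact hL w
    rwa [e] at h
  · calc ∫ w, (φ w : ℂ) * (thetaFEPair w).Λ₀ s = ∫ w, ∫ t in Ioi 0, F w t := by simp_rw [hL]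
      _ = ∫ t in Ioi 0, ∫ w, F w t := hswap
      _ = ∫ t : ℝ in Ioi 0, (t : ℂ) ^ (s - 1) * (phiThetaFEPair hφ).f_modif t :=
          setIntegral_congr_fun measurableSet_Ioi hR
      _ = (phiThetaFEPair hφ).Λ₀ s := by
          rw [WeakFEPair.Λ₀, mellin]
          simp_rw [smul_eq_mul]

/-- **Local integrability of `w ↦ Λ₀,w(s)` and of `E*(·, s)`** for every `s`. [folklore] -/
theorem locallyIntegrable_Lambda₀ (s : ℂ) : LocallyIntegrable fun w : ℍ => (thetaFEPair w).Λ₀ s := by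
  refine (locallyIntegrable_iff).mpr fun K hK => ?_
  have h := (integral_mul_Lambda₀ (isTestWeight_indicator hK) s).1
  rw [← integrable_indicator_iff hK.isClosed.measurableSet]
  refine h.congr (Eventually.of_forall fun w => ?_)
  by_cases hw : w ∈ K <;> simp [hw]

/-- `E*(·, s)` is locally integrable on `ℍ`, for every `s`. [folklore] -/
theorem locallyIntegrable_completedEisenstein (s : ℂ) : LocallyIntegrable fun w : ℍ => completedEisenstein w s := by
  have e : (fun w : ℍ => completedEisenstein w s) =
      fun w => (1 / 2) * (thetaFEPair w).Λ₀ s - (1 / (2 * s) + 1 / (2 * (1 - s))) := by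
    funext w
    rw [completedEisenstein_eq]
    unfold completedEisenstein₀
    ring
  rw [e]
  exact ((locallyIntegrable_Lambda₀ s).smul (1 / 2 : ℂ)).sub (locallyIntegrable_const _)

/-! ### `L_k E*(·, s) = h_k E*(·, s)` for all `s ≠ 0, 1` by analytic continuation -/

/-- **`L_k E*(·, s)(z) = Λ̃(s)/2`**, the meromorphic Mellin transform of the smoothed theta pair with
weight `φ = k(u(z, ·))`. [folklore] -/
theorem invariantOperator_completedEisenstein_eq_Lambda {k : ℝ → ℝ} (hk : IsTestKernel k) (z : ℍ) (s : ℂ) :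
    invariantOperator k (fun w => completedEisenstein w s) z =
      (phiThetaFEPair (isTestWeight_kernel hk z)).Λ s / 2 := by
  have hφ := isTestWeight_kernel hk z
  have h0 := integral_mul_Lambda₀ hφ s
  have hint1 : Integrable fun w => (k (pointPairInv z w) : ℂ) := by
    simpa using hφ.integrable_mul (g := fun _ => (1 : ℂ)) (locallyIntegrable_const 1)
  have e : ∀ w, (k (pointPairInv z w) : ℂ) * completedEisenstein w s =
      (1 / 2) * ((k (pointPairInv z w) : ℂ) * (thetaFEPair w).Λ₀ s) -
        ((1 / 2) * s⁻¹ + (1 / 2) * (1 - s)⁻¹) * (k (pointPairInv z w) : ℂ) := by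
    intro w
    rw [completedEisenstein_eq]
    unfold completedEisenstein₀
    rw [one_div (2 * s), one_div (2 * (1 - s)), mul_inv, mul_inv]
    ring
  unfold invariantOperator
  simp_rw [e]
  rw [integral_sub (h0.1.const_mul _) (hint1.const_mul _), integral_const_mul, integral_const_mul, h0.2,
    WeakFEPair.Λ]
  simp only [phiThetaFEPair, phiMass, smul_eq_mul, Complex.ofReal_one]
  ring

/-- **`s ↦ L_k E*(·, s)(z)` is holomorphic off `{0, 1}`.** [folklore] -/
theorem differentiableAt_invariantOperator_completedEisenstein {k : ℝ → ℝ} (hk : IsTestKernel k) (z : ℍ)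
    {s : ℂ} (hs0 : s ≠ 0) (hs1 : s ≠ 1) :
    DifferentiableAt ℂ (fun s => invariantOperator k (fun w => completedEisenstein w s) z) s := by
  have e : (fun s => invariantOperator k (fun w => completedEisenstein w s) z) =
      fun s => (phiThetaFEPair (isTestWeight_kernel hk z)).Λ s / 2 :=
    funext fun s => invariantOperator_completedEisenstein_eq_Lambda hk z s
  rw [e]
  refine ((phiThetaFEPair (isTestWeight_kernel hk z)).differentiableAt_Λ (Or.inl hs0) (Or.inl ?_)).div_const 2
  simpa [phiThetaFEPair] using hs1

/-- For `Re s > 1`: `L_k E*(·, s) = h(t) E*(·, s)`, `s = 1/2 + it` — from `ModularEisensteinSeries`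
(`E* = θ(s) E` there). [cite: Iwaniec2002, §3.2 & Thm 1.16, PDF pp. 24, 43] -/
theorem invariantOperator_completedEisenstein_of_one_lt_re {k : ℝ → ℝ} (hk : IsTestKernel k) {s : ℂ}
    (hs : 1 < s.re) (z : ℍ) :
    invariantOperator k (fun w => completedEisenstein w s) z =
      selbergTransform k (-Complex.I * (s - 1 / 2)) * completedEisenstein z s := by
  have e : (fun w => completedEisenstein w s) =
      fun w => ((π : ℂ) ^ (-s) * Complex.Gamma s * riemannZeta (2 * s)) * eisensteinE w s :=
    funext fun w => completedEisenstein_eq_theta_mul w hs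
  rw [e, invariantOperator_const_mul, invariantOperator_eisensteinE hk hs z, completedEisenstein_eq_theta_mul z hs]
  ring

/-- `ℂ ∖ {0, 1}` is preconnected. [folklore] -/
theorem isPreconnected_compl_zero_one : IsPreconnected {s : ℂ | s ≠ 0 ∧ s ≠ 1} := by
  have e : {s : ℂ | s ≠ 0 ∧ s ≠ 1} = ({0, 1} : Set ℂ)ᶜ := by
    ext s; simp [not_or]
  rw [e]
  refine (Set.Countable.isConnected_compl_of_one_lt_rank ?_ (Set.toFinite _).countable).isPreconnected
  rw [Complex.rank_real_complex]
  exact Cardinal.one_lt_two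

/-- **`L_k E*(·, s) = h(t) E*(·, s)` for all `s ≠ 0, 1`** (`s = 1/2 + it`): both sides are holomorphic on
the connected open set `ℂ ∖ {0, 1}` and agree for `Re s > 1` — the identity theorem. This is the
analytic continuation of the eigen-property of the Eisenstein series through its integral-operator
form (Theorems 1.9/1.15/1.16), as needed for the spectral decomposition on `Re s = 1/2`
(Iwaniec §3.4, p. 47, and §7). [cite: Iwaniec2002, §3.4 & Thm 1.16, PDF pp. 24, 47] -/
theorem invariantOperator_completedEisenstein {k : ℝ → ℝ} (hk : IsTestKernel k) {s : ℂ} (hs0 : s ≠ 0)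
    (hs1 : s ≠ 1) (z : ℍ) :
    invariantOperator k (fun w => completedEisenstein w s) z =
      selbergTransform k (-Complex.I * (s - 1 / 2)) * completedEisenstein z s := by
  set U : Set ℂ := {s : ℂ | s ≠ 0 ∧ s ≠ 1} with hU
  set Φ : ℂ → ℂ := fun s => invariantOperator k (fun w => completedEisenstein w s) z -
    selbergTransform k (-Complex.I * (s - 1 / 2)) * completedEisenstein z s with hΦ
  have hUo : IsOpen U := isOpen_ne.inter isOpen_ne
  have hdiff : DifferentiableOn ℂ Φ U := by
    intro s hs
    refine DifferentiableAt.differentiableWithinAt ?_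
    refine (differentiableAt_invariantOperator_completedEisenstein hk z hs.1 hs.2).sub ?_
    refine DifferentiableAt.mul ?_ (differentiableAt_completedEisenstein z hs.1 hs.2)
    exact ((differentiable_selbergTransform hk).comp
      ((differentiable_const _).mul (differentiable_id.sub (differentiable_const _)))).differentiableAt
  have hA : AnalyticOnNhd ℂ Φ U := hdiff.analyticOnNhd hUo
  have h2 : (2 : ℂ) ∈ U := ⟨two_ne_zero, by norm_num⟩
  have hev : Φ =ᶠ[𝓝 (2 : ℂ)] 0 := by
    have hopen : IsOpen {s : ℂ | 1 < s.re} := isOpen_lt continuous_const Complex.continuous_re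
    filter_upwards [hopen.mem_nhds (show (1 : ℝ) < (2 : ℂ).re by norm_num)] with s hs
    simp only [hΦ, Pi.zero_apply, sub_eq_zero]
    exact invariantOperator_completedEisenstein_of_one_lt_re hk hs z
  have h := hA.eqOn_zero_of_preconnected_of_eventuallyEq_zero isPreconnected_compl_zero_one h2 hev ⟨hs0, hs1⟩
  simpa [hΦ, sub_eq_zero] using h

/-- **`E*(·, s)` is a `C²` eigenfunction of `Δ` for every `s ≠ 0, 1`:** `(Δ + s(1 - s)) E*(·, s) = 0`
(the regularity criterion `isC2_and_eigen_of_invariantOperator` of `InvariantOperatorRegularity.lean`).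
[cite: Iwaniec2002, §3.4 (continuation of E(z,s) ∈ A_s), PDF p. 47] -/
theorem isC2_and_eigen_completedEisenstein {s : ℂ} (hs0 : s ≠ 0) (hs1 : s ≠ 1) :
    IsC2 (fun z => completedEisenstein z s) ∧
      ∀ z, hypLaplacian (fun z => completedEisenstein z s) z + s * (1 - s) * completedEisenstein z s = 0 := by
  set t : ℂ := -Complex.I * (s - 1 / 2) with ht
  have h := isC2_and_eigen_of_invariantOperator (locallyIntegrable_completedEisenstein s) t
    (fun k hk z => invariantOperator_completedEisenstein hk hs0 hs1 z)
  refine ⟨h.1, fun z => ?_⟩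
  have e : (1 / 4 : ℂ) + t ^ 2 = s * (1 - s) := by
    rw [ht]; ring_nf; rw [Complex.I_sq]; ring
  rw [← e]
  exact h.2 z

/-- `E*(·, s)` is automorphic for the modular group (as a subgroup of `GL₂(ℝ)`), every `s`. [folklore] -/
theorem isAutomorphic_completedEisenstein (s : ℂ) :
    IsAutomorphic (𝒮ℒ : Subgroup (GL (Fin 2) ℝ)) (fun z => completedEisenstein z s) := by
  intro γ hγ z
  obtain ⟨g, rfl⟩ := hγ
  have e : (Matrix.SpecialLinearGroup.mapGL ℝ g : GL (Fin 2) ℝ) • z = g • z := rfl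
  show completedEisenstein ((Matrix.SpecialLinearGroup.mapGL ℝ g : GL (Fin 2) ℝ) • z) s = completedEisenstein z s
  rw [e, completedEisenstein_smul]

/-! ### The Eisenstein series on the critical line `Re s = 1/2` -/

/-- `s(r) = 1/2 + ir`. [folklore] -/
noncomputable def critS (r : ℝ) : ℂ := 1 / 2 + Complex.I * r

/-- `s(r) ≠ 0`. [folklore] -/
theorem critS_ne_zero (r : ℝ) : critS r ≠ 0 := by
  intro h; have := congrArg Complex.re h; simp [critS] at this

/-- `s(r) ≠ 1`. [folklore] -/
theorem critS_ne_one (r : ℝ) : critS r ≠ 1 := by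
  intro h; have := congrArg Complex.re h; norm_num [critS] at this

/-- `r ↦ s(r)` is continuous. [folklore] -/
theorem continuous_critS : Continuous critS := by unfold critS; fun_prop

/-- **The regularised `θ`**: `θ̂(s) = 2s(1 - 2s) Λ₀(2s) - 1`, an entire function equal to
`2s(1 - 2s) θ(s)` with `θ(s) = π^{-s}Γ(s)ζ(2s) = Λ(2s)` ((3.27)) away from `s = 0, 1/2`; the factor
`2s(1 - 2s)` removes the poles of `θ` (at `s = 1/2` from `ζ(1)`, at `s = 0` from `Γ`). [cite: Iwaniec2002, (3.27), PDF p. 47] -/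
noncomputable def thetaHat (s : ℂ) : ℂ := 2 * s * (1 - 2 * s) * completedRiemannZeta₀ (2 * s) - 1

/-- `θ̂(s) = 2s(1 - 2s) Λ(2s)` for `s ≠ 0, 1/2`. [folklore] -/
theorem thetaHat_eq {s : ℂ} (h0 : s ≠ 0) (h1 : s ≠ 1 / 2) :
    thetaHat s = 2 * s * (1 - 2 * s) * completedRiemannZeta (2 * s) := by
  unfold thetaHat
  rw [completedRiemannZeta_eq]
  have h2 : (2 : ℂ) * s ≠ 0 := mul_ne_zero two_ne_zero h0
  have h3 : (1 : ℂ) - 2 * s ≠ 0 := by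
    intro h; apply h1
    linear_combination -h / 2
  field_simp
  ring

/-- `θ̂` is entire. [folklore] -/
theorem differentiable_thetaHat : Differentiable ℂ thetaHat := by
  unfold thetaHat
  have h : Differentiable ℂ fun s : ℂ => completedRiemannZeta₀ (2 * s) :=
    differentiable_completedZeta₀.comp (differentiable_id.const_mul _)
  exact ((((differentiable_const _).mul differentiable_id).mul
    ((differentiable_const _).sub ((differentiable_const _).mul differentiable_id))).mul h).sub
    (differentiable_const _)

/-- `θ̂(1/2) = -1` (minus the residue of `Λ` at `1`). [folklore] -/
theorem thetaHat_half : thetaHat (1 / 2) = -1 := by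
  unfold thetaHat; norm_num

/-- **`θ̂(1/2 + ir) ≠ 0` for all real `r`** — for `r ≠ 0` this is `ζ(1 + 2ir) ≠ 0`
(`riemannZeta_ne_zero_of_one_le_re`), for `r = 0` it is the pole of `ζ` at `1`. [folklore] -/
theorem thetaHat_critS_ne_zero (r : ℝ) : thetaHat (critS r) ≠ 0 := by
  rcases eq_or_ne r 0 with rfl | hr
  · have : critS 0 = 1 / 2 := by simp [critS]
    rw [this, thetaHat_half]; norm_num
  have h0 := critS_ne_zero r
  have h1 : critS r ≠ 1 / 2 := by
    intro h; have := congrArg Complex.im h; simp [critS, hr] at this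
  rw [thetaHat_eq h0 h1]
  set u : ℂ := 2 * critS r with hu
  have hure : u.re = 1 := by simp [hu, critS]
  have hu0 : u ≠ 0 := fun h => by have := congrArg Complex.re h; rw [hure] at this; simp at this
  have hu1 : (1 : ℂ) - u ≠ 0 := by
    intro h; have := congrArg Complex.im h; simp [hu, critS, hr] at this
  have hζ : riemannZeta u ≠ 0 := riemannZeta_ne_zero_of_one_le_re (by rw [hure])
  have hΛ : completedRiemannZeta u ≠ 0 := by
    intro h
    apply hζ
    rw [riemannZeta_def_of_ne_zero hu0, h, zero_div]
  have e : (2 : ℂ) * critS r * (1 - 2 * critS r) * completedRiemannZeta (2 * critS r) = u * (1 - u) * completedRiemannZeta u := by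
    rw [hu]
  rw [e]
  exact mul_ne_zero (mul_ne_zero hu0 hu1) hΛ

/-- The normalising factor `c(r) = 2s(1 - 2s)/θ̂(s) = 1/θ(s)`, `s = 1/2 + ir` (`= 0` at `r = 0`, where
`θ` has its pole and `E(z, 1/2) ≡ 0`, cf. Iwaniec p. 47). [folklore] -/
noncomputable def critFactor (r : ℝ) : ℂ := 2 * critS r * (1 - 2 * critS r) / thetaHat (critS r)

/-- `r ↦ c(r)` is continuous. [folklore] -/
theorem continuous_critFactor : Continuous critFactor := by
  unfold critFactor
  refine Continuous.div ((continuous_const.mul continuous_critS).mul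
    (continuous_const.sub (continuous_const.mul continuous_critS)))
    (differentiable_thetaHat.continuous.comp continuous_critS) thetaHat_critS_ne_zero

/-- **The Eisenstein series of `SL₂(ℤ)` on the critical line**, `E(z, 1/2 + ir) := c(r) E*(z, 1/2 + ir)`
with `c(r) = 1/θ(1/2 + ir)` (regularised at `r = 0`): the meromorphically continued `E(z, s)` of
(3.20)/(3.29) restricted to `Re s = 1/2`. [cite: Iwaniec2002, §3.4 (3.29)–(3.31), PDF p. 47] -/
noncomputable def eisensteinCrit (z : ℍ) (r : ℝ) : ℂ := critFactor r * completedEisenstein z (critS r)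

/-- **Automorphy** of `E(·, 1/2 + ir)`. [cite: Iwaniec2002, §3.1 (3.1), PDF p. 40] -/
theorem isAutomorphic_eisensteinCrit (r : ℝ) :
    IsAutomorphic (𝒮ℒ : Subgroup (GL (Fin 2) ℝ)) (fun z => eisensteinCrit z r) := by
  intro γ hγ z
  show critFactor r * completedEisenstein (γ • z) (critS r) = critFactor r * completedEisenstein z (critS r)
  have h := isAutomorphic_completedEisenstein (critS r) γ hγ z
  simp only at h
  rw [h]

/-- **`E(·, 1/2 + ir)` is `C²` with `(Δ + 1/4 + r²) E(·, 1/2 + ir) = 0`** — the fields `isC2_E`, `eigen_E`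
of `ModularSpectralDatum`. [cite: Iwaniec2002, §3.4 & (7.17), PDF pp. 47, 76] -/
theorem isC2_and_eigen_eisensteinCrit (r : ℝ) :
    IsC2 (fun z => eisensteinCrit z r) ∧
      ∀ z, hypLaplacian (fun z => eisensteinCrit z r) z + ((1 / 4 + r ^ 2 : ℝ) : ℂ) * eisensteinCrit z r = 0 := by
  obtain ⟨hC2, heig⟩ := isC2_and_eigen_completedEisenstein (critS_ne_zero r) (critS_ne_one r)
  refine ⟨hC2.const_mul (critFactor r), fun z => ?_⟩
  unfold eisensteinCrit
  rw [hypLaplacian_const_mul' hC2]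
  have e : (((1 / 4 + r ^ 2 : ℝ)) : ℂ) = critS r * (1 - critS r) := by
    unfold critS; push_cast; ring_nf; rw [Complex.I_sq]; ring
  rw [e]
  have := heig z
  linear_combination (critFactor r) * this

/-- **Continuity in the spectral parameter**: `r ↦ E(z, 1/2 + ir)` is continuous — the field
`continuous_E` of `ModularSpectralDatum`. [folklore] -/
theorem continuous_eisensteinCrit (z : ℍ) : Continuous fun r => eisensteinCrit z r := by
  unfold eisensteinCrit
  refine continuous_critFactor.mul (continuous_iff_continuousAt.mpr fun r => ?_)
  exact (differentiableAt_completedEisenstein z (critS_ne_zero r) (critS_ne_one r)).continuousAt.comp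
    continuous_critS.continuousAt

/-- **`L_k E(·, 1/2 + ir) = h(r) E(·, 1/2 + ir)`** for every test kernel `k` (Theorem 1.16 on the
critical line). [cite: Iwaniec2002, Thm 1.16, PDF p. 24] -/
theorem invariantOperator_eisensteinCrit {k : ℝ → ℝ} (hk : IsTestKernel k) (r : ℝ) (z : ℍ) :
    invariantOperator k (fun w => eisensteinCrit w r) z = selbergTransform k r * eisensteinCrit z r := by
  unfold eisensteinCrit
  rw [invariantOperator_const_mul, invariantOperator_completedEisenstein hk (critS_ne_zero r) (critS_ne_one r)]
  have e : -Complex.I * (critS r - 1 / 2) = r := by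
    unfold critS; ring_nf; rw [Complex.I_sq]; ring
  rw [e]; ring

end CriticalLine

end Literature.NumberTheory.Automorphic
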